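import Summits.AtomisticToContinuum.FouriersLaw.Theses.EmbeddedDrudeMourre
import Summits.AtomisticToContinuum.FouriersLaw.Theses.StaticAbelianSqueeze
import Literature.Barriers.AtomisticToContinuum.HarmonicCrystalBallisticProofs

/-!
# Disproof of `UniformAbelianRegularity` — findings (cdisprove seat, cycle 1, 2026-08-17)

Crux item stmt-AtomisticToContinuum-13416, decl
`Summit.AtomisticToContinuum.FouriersLaw.Theses.EmbeddedDrudeMourre.UniformAbelianRegularity` (= the
`StaticAbelianSqueeze` / `HoelderEscapeProfile` / `CoercivePulse` / `CageBudgetFekete` copies, `crux_eq_twin`):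

  (R)  ∀ ω₂ lam β γ > 0, ∀ T > 0, ∀ ε > 0 ∃ ν₀ > 0 ∀ ν ∈ (0, ν₀) ∃ N₀ ∀ N ≥ N₀,
       |∫_{t>0} (1 − e^{−νt}) c_N(t) dt| ≤ ε N,
  c_N(t) = ∫ J · (P_t J) d(gibbsMeasure N T),  J = Σ_i bondCurrent N i,  P_t = transitionKernel N T T t.

VERDICT OF THIS CYCLE: NOT REFUTED — no kill.  The formalisation is honest (every junk branch of the Bochner
integrals makes (R) TRUE, never false; §0), and with the PROVED open-chain Kubo identity (K)
(`StaticAbelianSqueeze.kuboAbelIdentity_holds`: `c_N ∈ L¹(0,∞)`, `∫₀^∞ c_N = (N−1)T²D_N`) the content of (R) is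
exactly "BLR's κ(T) = lim D_N exists AND equals the Abelian bulk Green–Kubo value" — Fourier's law for the pinned
quartic chain with matching constants, an open problem with no counterexample in print or in physics folklore
(fluctuating hydrodynamics of the OPEN chain predicts |S_N(ν)| ≈ c·N√ν + O(1), see §C).

LANDED (importable): p148790 @ dfc95003dd45 —
`Summits.AtomisticToContinuum.FouriersLaw.Theorems.UniformAbelianRegularity.Negative.HarmonicCornerTwoScale`
(`harmonic_false_of`, `gk_linear_of_abelRegular`, `exists_family_not_abelRegular`, `false_without_epsPos`,
`false_without_anharmonicity_of`, helpers `abs_integral_exp_mul_le`, `integral_split_abel`, `integral_exp_neg_mul`,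
`twoScale_closedForms`, `crux_eq_twin`; definition-free spellings of §A–§B below).

What this file contains (kernel-checked unless marked NEAR-MISS):
* §0 read-back: `uniformAbelianRegularity_iff` (the crux = `RegularAt` at every admissible point, `Iff.rfl`),
  `crux_eq_twin`, `kuboAbelIdentity_iff` (the landed (K) = `KuboIdentityAt` pointwise).
* §A LOAD-BEARING HYPOTHESES.
  - `false_without_epsPos`: the guard `0 < ε` is load-bearing (trivial, recorded for completeness).
  - `regularAt_harmonic_false` (**any proof must use `lam > 0 ∨ β > 0`**): at the harmonic corner
    `lam = β = 0` (R) FAILS at every `T > 0`, MODULO the `lam = β = 0` instances of three theorems that are LANDED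
    for `lam, β > 0` — weak-NESS uniqueness (`NessUnique_holds`), the KDN identity (`kuboAbelIdentity_holds`) and the
    equal-time bound (`stub_equalTimeBound`, p144650).  Mechanism: PROVED Rieder–Lebowitz–Lieb law
    `HarmonicChainBallisticFlux_holds` ⇒ `∫₀^∞ c_{M+1} = M²T²c_{M+1}` with `c_{M+1} → c_∞ > 0` (quadratic), while
    the Abel side is `|∫ e^{−νt}c_N| ≤ C N/ν` (linear) — the deficit is ≥ ½c_∞T²N² eventually.  Corollary
    `false_without_anharmonicity_of`: the `lam, β ≥ 0` extension of the crux is false modulo the same three facts.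
  - docstring census of the other guards (all JUNK-TRUE when dropped, hence not refutation handles):
    `γ = 0` (isolated Hamiltonian chain: `c_N` almost periodic, non-integrable ⇒ outer Bochner integral = 0);
    `T ≤ 0` (`gibbsMeasure = volume.tilted` of a non-integrable weight = 0); `ω₂ = lam = 0` (no confinement, Gibbs
    weight non-normalisable ⇒ 0).  Single drops `lam = 0 < β` (pinned FPU-β) or `β = 0 < lam` (discrete φ⁴) are
    PHYSICALLY NOT load-bearing (both are standard normal conductors numerically; (R) is an EQUILIBRIUM statement,
    so CEHR's condition C5 `deg V ≥ deg U`, violated by φ⁴, is irrelevant to it) — information for provers: an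
    argument may use anharmonicity of either kind, but every tree lemma about `gibbsMeasure`/`transitionKernel`
    moments is currently stated with `0 < β`.
* §B NATURAL STRENGTHENING REFUTED / which property of `c_N` is load-bearing: `twoScale_not_regularShape` — an
  explicit positive-definite family `c_N(t) = N e^{−t} + N⁻¹ e^{−t/N²}` with the equal-time bound `|c_N| ≤ 2N`,
  `c_N ∈ L¹` for each `N`, LINEAR Green–Kubo integral `∫₀^∞ c_N = 2N` (bounded response!) and `c_N/N → e^{−t}`
  pointwise, whose Abel deficit is `≥ N/2` for `N ≥ ν^{−1/2}`: so (equal-time bound ∧ fixed-N integrability ∧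
  bounded response ∧ pointwise bulk limit) ⇏ (R).  (R) is strictly stronger than `HasBoundedResponse`: it pins WHERE
  in time the Green–Kubo weight sits (no weight ≍ N at times ≍ N²).  The family violates exactly the N-uniform
  tail stubs of both registered lines (`stub_uniformL1Tail` of Lines/birth.lean; `PostCrossingSaturation` K1 and the
  exponential splice error of `LinearHorizonSplice` K3 of the picked Sketch line) — those stubs are therefore the
  load-bearing ones, as their cards say.
* §C LINE `Sketch` (zero-mean-dyadic-splice, PICKED 2026-08-17) pre-assessment, no stub killed: P3
  (`ZeroMeanWindowLemma`) is a TRUE real-analysis lemma (two integrations by parts: Ŵ(ω) = −ν/(ν²+ω²) +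
  O((τ⁻¹+ν)/ω²) off the window, approximate identities of widths ν and 1/τ on it); K3/K4/K1 are consistent with
  the linear fluctuating-hydrodynamics caricature of the open chain (boundary term `−D²T² wᵀe^{−At}w`, `t^{−3/2}`
  after the Robin→Dirichlet crossover `t ≫ D/σ²`, image corrections `e^{−N²/4Dt}` — exponentially small at
  `t ≤ c₀N`, as K3 demands); the composition K3 ∧ K4 ∧ K1 ∧ P3 ⟹ (R) is sound on paper (Bonnet needs only
  monotonicity of `(1−χ(t/c₀N))(1−e^{−νt})`).  Remark for the lead: K4 asks a HÖLDER window density at EVERY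
  `T > 0`, strictly more than this route's engine `DrudeDissolution` delivers (continuity, `T < T₀` only).
* §D NEAR-MISSES (sorried, docstrings say why): the unconditional harmonic failure (needs the three `β = 0`
  extensions above; the tree's `pinnedChain_uniformMixing` is stated with `0 < β`).

Numerics in hand (not mine): refuter-rattack job j004206 (harmonic calibration `I_N(ν)/N ~ N`), strategist census
STRATEGY-CENSUS.md (twin crux 12596/14013): `(1,1,1,1,1)` is ballistic up to `N = 64`; predicted modulus
`N√ν + O(1)`; corrector-norm / H₋₁ routes are dead (‖(−L_N)⁻¹J‖² ≳ N²).  No new compute job was needed for the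
conclusions of this file.
-/

noncomputable section

namespace Summit.AtomisticToContinuum.FouriersLaw.Cruxes.UniformAbelianRegularity.Disproof

open MeasureTheory Filter Set Topology
open Literature.MathematicalPhysics.KineticTheory.HeatConduction
open Literature.Barriers.AtomisticToContinuum (HarmonicChainBallisticFlux HarmonicChainBallisticFlux_holds)
open Summit.AtomisticToContinuum.FouriersLaw.Theses

/-! ## §0 Read-back: the crux through named objects -/

/-- `c_N(t)`: the equilibrium total-current autocorrelation of the open `N`-chain with both baths at `T`,
verbatim the inner integrand of the crux, at an ARBITRARY parameter point (no sign guards). -/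
def autocorr (ω₂ lam β γ T : ℝ) (N : ℕ) (t : ℝ) : ℝ :=
  ∫ z, (∑ i : Fin N, (pinnedChain ω₂ lam β γ).bondCurrent N i z) *
      (∫ y, (∑ i : Fin N, (pinnedChain ω₂ lam β γ).bondCurrent N i y)
        ∂((pinnedChain ω₂ lam β γ).transitionKernel N T T t.toNNReal z))
    ∂((pinnedChain ω₂ lam β γ).gibbsMeasure N T)

/-- `S_N(ν) = ∫_{t>0} (1 − e^{−νt}) c_N(t) dt`: the Abel deficit. -/
def abelDeficit (ω₂ lam β γ T : ℝ) (N : ℕ) (ν : ℝ) : ℝ :=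
  ∫ t in Ioi (0:ℝ), (1 - Real.exp (-(ν * t))) * autocorr ω₂ lam β γ T N t

/-- The (R)-SHAPE of an abstract two-parameter family `S N ν`. -/
def RegularShape (S : ℕ → ℝ → ℝ) : Prop :=
  ∀ ε : ℝ, 0 < ε → ∃ ν₀ : ℝ, 0 < ν₀ ∧ ∀ ν : ℝ, 0 < ν → ν < ν₀ →
    ∃ N₀ : ℕ, ∀ N : ℕ, N₀ ≤ N → |S N ν| ≤ ε * N

/-- (R) at one parameter point. -/
def RegularAt (ω₂ lam β γ T : ℝ) : Prop :=
  RegularShape (abelDeficit ω₂ lam β γ T)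

/-- READ-BACK: the crux is `RegularAt` at every admissible parameter point (definitional). -/
theorem uniformAbelianRegularity_iff :
    EmbeddedDrudeMourre.UniformAbelianRegularity ↔
      ∀ ω₂ lam β γ : ℝ, 0 < ω₂ → 0 < lam → 0 < β → 0 < γ → ∀ T : ℝ, 0 < T →
        RegularAt ω₂ lam β γ T :=
  Iff.rfl

/-- The five route copies are one proposition (here: this route's and the skeleton's). -/
theorem crux_eq_twin :
    EmbeddedDrudeMourre.UniformAbelianRegularity = StaticAbelianSqueeze.UniformAbelianRegularity :=
  rfl

/-! ## §A Load-bearing hypotheses -/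

/-! ### §A.1 The guard `0 < ε` -/

/-- The crux with the guard `0 < ε` deleted. -/
def WithoutEpsPos : Prop :=
  ∀ ω₂ lam β γ : ℝ, 0 < ω₂ → 0 < lam → 0 < β → 0 < γ → ∀ T : ℝ, 0 < T → ∀ ε : ℝ,
    ∃ ν₀ : ℝ, 0 < ν₀ ∧ ∀ ν : ℝ, 0 < ν → ν < ν₀ →
      ∃ N₀ : ℕ, ∀ N : ℕ, N₀ ≤ N → |abelDeficit ω₂ lam β γ T N ν| ≤ ε * N

/-- `0 < ε` is (trivially) load-bearing: at `ε = −1` the bound is negative for `N ≥ 1`. -/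
theorem false_without_epsPos : ¬ WithoutEpsPos := by
  intro h
  obtain ⟨ν₀, hν₀, h⟩ := h 1 1 1 1 one_pos one_pos one_pos one_pos 1 one_pos (-1)
  obtain ⟨N₀, hN⟩ := h (ν₀ / 2) (by positivity) (by linarith)
  have h1 := hN (N₀ + 1) (Nat.le_succ _)
  have h0 : (0:ℝ) ≤ |abelDeficit 1 1 1 1 1 (N₀ + 1) (ν₀ / 2)| := abs_nonneg _
  have h2 : (0:ℝ) < ((N₀ + 1 : ℕ) : ℝ) := by positivity
  linarith

/-! ### §A.2 Anharmonicity: the harmonic corner `lam = β = 0`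

The three hypotheses below are the `(ω₂, 0, 0, γ)` instances of decls PROVED in the tree for `lam, β > 0`:
`NessUniqueAt` ← `…Theses.*.NessUnique` (`NessUnique_holds`), `KuboIdentityAt` ← the body of
`StaticAbelianSqueeze.KuboAbelIdentity` (`kuboAbelIdentity_holds`, `kuboAbelIdentity_iff` below), `EqualTimeBoundAt` ←
`stub_equalTimeBound` (p144650).  All three are true in print at the harmonic corner (linear SDE with controllable
noise: unique Gaussian invariant measure; KDN identity = a finite-dimensional Gaussian computation; `Var_μ(J) ≤ 3MN`
and Cauchy–Schwarz with stationarity), but the tree's proofs (`pinnedChain_uniformMixing`, the moment bounds of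
`EmbeddedDrudeMourreAbelThermodynamicLimitCentralBondCurrentSecondMoments`) are stated with `0 < β`. -/

/-- Weak-NESS uniqueness at a parameter point. -/
def NessUniqueAt (ω₂ lam β γ : ℝ) : Prop :=
  ∀ (N : ℕ) (T_L T_R : ℝ), 0 < T_L → 0 < T_R → ∀ μ ν : Measure (PhaseSpace N),
    (pinnedChain ω₂ lam β γ).IsSteadyState N T_L T_R μ →
      (pinnedChain ω₂ lam β γ).IsSteadyState N T_L T_R ν → μ = ν

/-- The Kundu–Dhar–Narayan open-chain Kubo identity at a parameter point: the body of
`StaticAbelianSqueeze.KuboAbelIdentity` with the four sign guards removed. -/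
def KuboIdentityAt (ω₂ lam β γ : ℝ) : Prop :=
  NessUniqueAt ω₂ lam β γ →
    ∀ μ : (N : ℕ) → ℝ → ℝ → Measure (PhaseSpace N),
      (∀ (N : ℕ) (T_L T_R : ℝ), 0 < T_L → 0 < T_R →
        (pinnedChain ω₂ lam β γ).IsSteadyState N T_L T_R (μ N T_L T_R)) →
      ∀ T : ℝ, 0 < T → ∀ N : ℕ, ∀ D : ℝ,
        Tendsto (fun δ : ℝ => (pinnedChain ω₂ lam β γ).totalCurrent (μ N (T + δ / 2) (T - δ / 2)) / δ)
          (𝓝[≠] 0) (𝓝 D) →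
        IntegrableOn (autocorr ω₂ lam β γ T N) (Ioi 0) ∧
          ((N:ℝ) - 1) * T ^ 2 * D = ∫ t in Ioi (0:ℝ), autocorr ω₂ lam β γ T N t

/-- READ-BACK of (K): the landed item `KuboAbelIdentity` is `KuboIdentityAt` at every admissible point
(definitional), so `kuboAbelIdentity_holds` discharges `KuboIdentityAt ω₂ lam β γ` whenever `lam, β > 0`. -/
theorem kuboAbelIdentity_iff :
    StaticAbelianSqueeze.KuboAbelIdentity ↔
      ∀ ω₂ lam β γ : ℝ, 0 < ω₂ → 0 < lam → 0 < β → 0 < γ → KuboIdentityAt ω₂ lam β γ :=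
  Iff.rfl

/-- N-linear equal-time bound at a parameter point (the shape of the landed `stub_equalTimeBound`, with its
harmless `N₀` set to `0`). -/
def EqualTimeBoundAt (ω₂ lam β γ T : ℝ) : Prop :=
  ∃ C : ℝ, ∀ (N : ℕ) (t : ℝ), 0 < t → |autocorr ω₂ lam β γ T N t| ≤ C * N

/-- Abel side is at most linear: `|∫ e^{−νt} c_N| ≤ C N / ν` under the equal-time bound (pure bookkeeping). -/
theorem abs_integral_exp_mul_le {c : ℝ → ℝ} {B ν : ℝ} (hν : 0 < ν)
    (hbd : ∀ t : ℝ, 0 < t → |c t| ≤ B) :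
    |∫ t in Ioi (0:ℝ), Real.exp (-(ν * t)) * c t| ≤ B / ν := by
  have hexp : IntegrableOn (fun t : ℝ => Real.exp (-ν * t)) (Ioi 0) :=
    integrableOn_exp_mul_Ioi (by linarith) 0
  have hg : IntegrableOn (fun t : ℝ => B * Real.exp (-ν * t)) (Ioi 0) := hexp.const_mul B
  have hle : ∀ᵐ t ∂(volume.restrict (Ioi (0:ℝ))),
      ‖Real.exp (-(ν * t)) * c t‖ ≤ B * Real.exp (-ν * t) := by
    refine (ae_restrict_iff' measurableSet_Ioi).2 (Eventually.of_forall fun t ht => ?_)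
    rw [norm_mul, Real.norm_eq_abs, Real.norm_eq_abs, abs_of_pos (Real.exp_pos _), neg_mul, mul_comm]
    exact mul_le_mul_of_nonneg_right (hbd t ht) (Real.exp_pos _).le
  have h1 := norm_integral_le_of_norm_le hg hle
  rw [Real.norm_eq_abs] at h1
  refine h1.trans (le_of_eq ?_)
  rw [integral_const_mul, integral_exp_mul_Ioi (by linarith : -ν < 0) 0]
  field_simp
  simp

/-- The Abelian split `∫ c = ∫ e^{−νt} c + ∫ (1 − e^{−νt}) c` for `c ∈ L¹(0,∞)` (as in the tree's
`integral_abelSplit`, re-proved to keep this file import-light). -/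
theorem integral_split_abel (c : ℝ → ℝ) {ν : ℝ} (hν : 0 < ν) (hc : IntegrableOn c (Ioi 0)) :
    ∫ t in Ioi (0:ℝ), c t = (∫ t in Ioi (0:ℝ), Real.exp (-(ν * t)) * c t) +
      ∫ t in Ioi (0:ℝ), (1 - Real.exp (-(ν * t))) * c t := by
  have hcont : Continuous fun t : ℝ => Real.exp (-(ν * t)) := by fun_prop
  have hcont' : Continuous fun t : ℝ => 1 - Real.exp (-(ν * t)) := by fun_prop
  have hle : ∀ t : ℝ, t ∈ Ioi (0:ℝ) → Real.exp (-(ν * t)) ≤ 1 := fun t ht =>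
    Real.exp_le_one_iff.2 (by have : 0 ≤ ν * t := mul_nonneg hν.le (le_of_lt ht); linarith)
  have h1 : IntegrableOn (fun t => Real.exp (-(ν * t)) * c t) (Ioi 0) := by
    refine Integrable.mono hc (hcont.aestronglyMeasurable.mul hc.aestronglyMeasurable) ?_
    refine (ae_restrict_iff' measurableSet_Ioi).2 (Eventually.of_forall fun t ht => ?_)
    rw [norm_mul, Real.norm_eq_abs, abs_of_pos (Real.exp_pos _)]
    exact mul_le_of_le_one_left (norm_nonneg _) (hle t ht)
  have h2 : IntegrableOn (fun t => (1 - Real.exp (-(ν * t))) * c t) (Ioi 0) := by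
    refine Integrable.mono hc (hcont'.aestronglyMeasurable.mul hc.aestronglyMeasurable) ?_
    refine (ae_restrict_iff' measurableSet_Ioi).2 (Eventually.of_forall fun t ht => ?_)
    have h0 : 0 ≤ 1 - Real.exp (-(ν * t)) := by linarith [hle t ht]
    have h1' : 1 - Real.exp (-(ν * t)) ≤ 1 := by linarith [Real.exp_pos (-(ν * t))]
    rw [norm_mul, Real.norm_eq_abs, abs_of_nonneg h0]
    exact mul_le_of_le_one_left (norm_nonneg _) h1'
  calc ∫ t in Ioi (0:ℝ), c t
      = ∫ t in Ioi (0:ℝ), (Real.exp (-(ν * t)) * c t + (1 - Real.exp (-(ν * t))) * c t) := by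
        congr 1; funext t; ring
    _ = (∫ t in Ioi (0:ℝ), Real.exp (-(ν * t)) * c t) +
          ∫ t in Ioi (0:ℝ), (1 - Real.exp (-(ν * t))) * c t := integral_add h1 h2

/-- **ABSTRACT CORE: (R)-shape + linear equal-time bound force a LINEAR Green–Kubo integral.**  If the Abel
deficits of a family `c N` have the (R)-shape and `|c N t| ≤ B N`, then whenever `c N ∈ L¹(0,∞)` eventually,
`∫₀^∞ c N ≤ K·N` eventually for some `K` — so a family with SUPERLINEAR Green–Kubo integrals (ballistic or
anomalous transport) violates (R).  This is the upper half of "(R) ⟹ HasBoundedResponse" read through (K). -/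
theorem gk_linear_of_regularShape (c : ℕ → ℝ → ℝ) {B : ℝ}
    (hbd : ∀ (N : ℕ) (t : ℝ), 0 < t → |c N t| ≤ B * N)
    (hR : RegularShape fun N ν => ∫ t in Ioi (0:ℝ), (1 - Real.exp (-(ν * t))) * c N t) :
    ∃ K : ℝ, ∃ N₀ : ℕ, ∀ N : ℕ, N₀ ≤ N → IntegrableOn (c N) (Ioi 0) →
      ∫ t in Ioi (0:ℝ), c N t ≤ K * N := by
  obtain ⟨ν₀, hν₀, hRν⟩ := hR 1 one_pos
  have hν : 0 < ν₀ / 2 := by positivity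
  obtain ⟨N₀, hN₀⟩ := hRν (ν₀ / 2) hν (by linarith)
  refine ⟨1 + B / (ν₀ / 2), N₀, fun N hN hint => ?_⟩
  have hsplit := integral_split_abel (c N) hν hint
  have hA := abs_integral_exp_mul_le (c := c N) hν (hbd N)
  have hS := hN₀ N hN
  have hA' := (le_abs_self _).trans hA
  have hS' := (le_abs_self _).trans hS
  rw [hsplit]
  have : B * ↑N / (ν₀ / 2) = B / (ν₀ / 2) * N := by ring
  nlinarith [hA', hS', this]

/-- **`lam > 0 ∨ β > 0` IS LOAD-BEARING: (R) fails at the harmonic corner**, for every `ω₂, γ, T > 0`, modulo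
the `lam = β = 0` instances of three facts landed for `lam, β > 0` (weak-NESS uniqueness, the KDN identity, the
equal-time bound).  Proof: along the Rieder–Lebowitz–Lieb steady family of the PROVED
`HarmonicChainBallisticFlux_holds` the response of the `(M+1)`-chain is `D_{M+1} = M c_{M+1}` with
`M c_{M+1} → +∞`; (K) turns this into `∫₀^∞ c_{M+1} = M T² (M c_{M+1})`, while (R) at `ε = 1`, `ν = ν₀/2` and
the equal-time bound give `∫₀^∞ c_{M+1} ≤ (M+1)(1 + 2C/ν₀)` (`gk_linear_of_regularShape`) — absurd for large
`M`.  Hence any proof of the crux must use the anharmonic couplings in a way that fails at `(lam, β) = (0,0)`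
(equivalently, by the scaling conjugacy, it cannot be temperature-uniform as `T → 0`; barrier
`LowTemperatureWeakAnharmonicity`). -/
theorem regularAt_harmonic_false {ω₂ γ T : ℝ} (hω : 0 < ω₂) (hγ : 0 < γ) (hT : 0 < T)
    (hU : NessUniqueAt ω₂ 0 0 γ) (hK : KuboIdentityAt ω₂ 0 0 γ) (hE : EqualTimeBoundAt ω₂ 0 0 γ T) :
    ¬ RegularAt ω₂ 0 0 γ T := by
  intro hR
  obtain ⟨μ, hμ, c, cinf, -, hresp, -, hup⟩ :=
    HarmonicChainBallisticFlux.ballisticLaw HarmonicChainBallisticFlux_holds hω hγ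
  obtain ⟨C, hC⟩ := hE
  -- (R) + equal-time bound ⇒ linear Green–Kubo integral
  obtain ⟨K, N₀, hlin⟩ := gk_linear_of_regularShape (autocorr ω₂ 0 0 γ T) hC hR
  -- (K) along the RLL family ⇒ quadratic Green–Kubo integral
  have hGK : ∀ M : ℕ, IntegrableOn (autocorr ω₂ 0 0 γ T (M + 1)) (Ioi 0) ∧
      (M:ℝ) * T ^ 2 * ((M:ℝ) * c (M + 1)) = ∫ t in Ioi (0:ℝ), autocorr ω₂ 0 0 γ T (M + 1) t := by
    intro M
    have h := hK hU μ hμ T hT (M + 1) ((M:ℝ) * c (M + 1)) (hresp T hT M)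
    refine ⟨h.1, ?_⟩
    have e : (((M + 1 : ℕ) : ℝ) - 1) = (M:ℝ) := by push_cast; ring
    rw [← h.2, e]
  -- choose M large: M ≥ N₀, M ≥ 1, and M c_{M+1} T² > 2|K| + 1
  have hev1 : ∀ᶠ M : ℕ in atTop, (2 * |K| + 1) / T ^ 2 ≤ (M:ℝ) * c (M + 1) :=
    hup.eventually (eventually_ge_atTop _)
  have hev2 : ∀ᶠ M : ℕ in atTop, N₀ ≤ M := eventually_ge_atTop N₀
  have hev3 : ∀ᶠ M : ℕ in atTop, 1 ≤ M := eventually_ge_atTop 1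
  obtain ⟨M, h1, h2, h3⟩ := (hev1.and (hev2.and hev3)).exists
  obtain ⟨hint, hval⟩ := hGK M
  have hle := hlin (M + 1) (by omega) hint
  rw [← hval] at hle
  have hT2 : 0 < T ^ 2 := by positivity
  have hMc : 2 * |K| + 1 ≤ (M:ℝ) * c (M + 1) * T ^ 2 := by
    rwa [div_le_iff₀ hT2] at h1
  have hM1 : (1:ℝ) ≤ M := by exact_mod_cast h3
  have hKabs : K ≤ |K| := le_abs_self K
  -- M T² (M c) ≥ M (2|K|+1) > K (M+1)
  have key : (M:ℝ) * (2 * |K| + 1) ≤ (M:ℝ) * T ^ 2 * ((M:ℝ) * c (M + 1)) := by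
    have := mul_le_mul_of_nonneg_left hMc (by positivity : (0:ℝ) ≤ M)
    linarith [this]
  have hcast : ((M + 1 : ℕ) : ℝ) = (M:ℝ) + 1 := by push_cast; ring
  rw [hcast] at hle
  nlinarith [key, hle, hKabs, hM1, abs_nonneg K]

/-- The crux extended to `lam, β ≥ 0`. -/
def WithoutAnharmonicity : Prop :=
  ∀ ω₂ lam β γ : ℝ, 0 < ω₂ → 0 ≤ lam → 0 ≤ β → 0 < γ → ∀ T : ℝ, 0 < T → RegularAt ω₂ lam β γ T

/-- **Corollary: the `lam, β ≥ 0` extension of the crux is FALSE** modulo the three harmonic-corner facts at one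
point `(ω₂, γ, T) = (1, 1, 1)`. -/
theorem false_without_anharmonicity_of (hU : NessUniqueAt 1 0 0 1) (hK : KuboIdentityAt 1 0 0 1)
    (hE : EqualTimeBoundAt 1 0 0 1 1) : ¬ WithoutAnharmonicity := fun h =>
  regularAt_harmonic_false one_pos one_pos one_pos hU hK hE (h 1 0 0 1 one_pos le_rfl le_rfl one_pos 1 one_pos)

/-! ## §B A natural strengthening refuted: which property of `c_N` the crux really asks for

`twoScale N t = N e^{−t} + N⁻¹ e^{−t/N²}`: a microscopic part of weight `N` plus a SLOW component of amplitude
`1/N` living on the time scale `N²` (the "slow hydrodynamic / breather mode" scenario of the item's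
why-it-might-fail, in caricature).  It is positive-definite (sum of `e^{−a|t|}`), obeys the equal-time bound,
is integrable for each `N` with the LINEAR Green–Kubo integral `2N`, and `twoScale N t / N → e^{−t}`; yet its Abel
deficit at frequency `ν` is `≥ N/2` as soon as `ν N² ≥ 1`.  So the (R)-shape does not follow from those four
properties: the N-UNIFORM control of the tail (birth's `stub_uniformL1Tail`, Sketch's K1/K3) is load-bearing. -/

/-- The two-scale family. -/
def twoScale (N : ℕ) (t : ℝ) : ℝ :=
  (N:ℝ) * Real.exp (-t) + (N:ℝ)⁻¹ * Real.exp (-((N:ℝ)^2)⁻¹ * t)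

/-- Equal-time bound `|twoScale N t| ≤ 2N` (`t ≥ 0`, `N ≥ 1`). -/
theorem abs_twoScale_le {N : ℕ} (hN : 1 ≤ N) {t : ℝ} (ht : 0 ≤ t) : |twoScale N t| ≤ 2 * N := by
  have hN' : (1:ℝ) ≤ N := by exact_mod_cast hN
  have h1 : Real.exp (-t) ≤ 1 := Real.exp_le_one_iff.2 (by linarith)
  have h2 : Real.exp (-((N:ℝ)^2)⁻¹ * t) ≤ 1 :=
    Real.exp_le_one_iff.2 (by have : 0 ≤ ((N:ℝ)^2)⁻¹ * t := by positivity
                              linarith)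
  have h3 : (N:ℝ)⁻¹ ≤ 1 := inv_le_one_of_one_le₀ hN'
  have hpos : 0 ≤ twoScale N t := by unfold twoScale; positivity
  rw [abs_of_nonneg hpos]
  unfold twoScale
  have e1 : (N:ℝ) * Real.exp (-t) ≤ N := mul_le_of_le_one_right (by positivity) h1
  have e2 : (N:ℝ)⁻¹ * Real.exp (-((N:ℝ)^2)⁻¹ * t) ≤ 1 := by
    calc (N:ℝ)⁻¹ * Real.exp (-((N:ℝ)^2)⁻¹ * t) ≤ 1 * 1 :=
          mul_le_mul h3 h2 (Real.exp_pos _).le zero_le_one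
      _ = 1 := by ring
  linarith

/-- `∫_{t>0} e^{−a t} = 1/a` and integrability, in the `-(a * t)` spelling used by the crux. -/
theorem integral_exp_neg_mul {a : ℝ} (ha : 0 < a) :
    IntegrableOn (fun t : ℝ => Real.exp (-(a * t))) (Ioi 0) ∧ ∫ t in Ioi (0:ℝ), Real.exp (-(a * t)) = 1 / a := by
  have e : (fun t : ℝ => Real.exp (-(a * t))) = fun t => Real.exp (-a * t) := by
    funext t; rw [neg_mul]
  rw [e]
  refine ⟨integrableOn_exp_mul_Ioi (by linarith) 0, ?_⟩
  rw [integral_exp_mul_Ioi (by linarith : -a < 0) 0]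
  simp [div_neg, neg_div]

/-- The Abel deficit of the two-scale family in closed form:
`∫ (1 − e^{−νt}) twoScale N t = N(1 − 1/(1+ν)) + N⁻¹ (N² − 1/(N⁻² + ν))` (`N ≥ 1`, `ν > 0`). -/
theorem abelDeficit_twoScale {N : ℕ} (hN : 1 ≤ N) {ν : ℝ} (hν : 0 < ν) :
    IntegrableOn (twoScale N) (Ioi 0) ∧
    ∫ t in Ioi (0:ℝ), (1 - Real.exp (-(ν * t))) * twoScale N t =
      (N:ℝ) * (1 - 1 / (1 + ν)) + (N:ℝ)⁻¹ * ((N:ℝ) ^ 2 - 1 / (((N:ℝ)^2)⁻¹ + ν)) := by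
  have hN' : (0:ℝ) < N := by exact_mod_cast hN
  have hN2 : (0:ℝ) < ((N:ℝ)^2)⁻¹ := by positivity
  -- the four exponential integrals
  obtain ⟨i1, v1⟩ := integral_exp_neg_mul one_pos
  obtain ⟨i2, v2⟩ := integral_exp_neg_mul (by linarith : (0:ℝ) < 1 + ν)
  obtain ⟨i3, v3⟩ := integral_exp_neg_mul hN2
  obtain ⟨i4, v4⟩ := integral_exp_neg_mul (by linarith : (0:ℝ) < ((N:ℝ)^2)⁻¹ + ν)
  have hts : twoScale N = fun t => (N:ℝ) * Real.exp (-(1 * t)) + (N:ℝ)⁻¹ * Real.exp (-(((N:ℝ)^2)⁻¹ * t)) := by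
    funext t; simp [twoScale, neg_mul]
  refine ⟨?_, ?_⟩
  · rw [hts]; exact (i1.const_mul _).add (i3.const_mul _)
  have hexp : ∀ a t : ℝ, Real.exp (-(ν * t)) * Real.exp (-(a * t)) = Real.exp (-((a + ν) * t)) := by
    intro a t; rw [← Real.exp_add]; congr 1; ring
  have hptw : (fun t => (1 - Real.exp (-(ν * t))) * twoScale N t) = fun t =>
      ((N:ℝ) * Real.exp (-(1 * t)) - (N:ℝ) * Real.exp (-((1 + ν) * t))) +
        ((N:ℝ)⁻¹ * Real.exp (-(((N:ℝ)^2)⁻¹ * t)) - (N:ℝ)⁻¹ * Real.exp (-((((N:ℝ)^2)⁻¹ + ν) * t))) := by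
    funext t
    rw [hts]
    simp only
    rw [← hexp 1 t, ← hexp (((N:ℝ)^2)⁻¹) t]
    ring
  have h1 : Integrable (fun t : ℝ => (N:ℝ) * Real.exp (-(1 * t))) (volume.restrict (Ioi 0)) :=
    i1.const_mul _
  have h2 : Integrable (fun t : ℝ => (N:ℝ) * Real.exp (-((1 + ν) * t))) (volume.restrict (Ioi 0)) :=
    i2.const_mul _
  have h3 : Integrable (fun t : ℝ => (N:ℝ)⁻¹ * Real.exp (-(((N:ℝ)^2)⁻¹ * t))) (volume.restrict (Ioi 0)) :=
    i3.const_mul _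
  have h4 : Integrable (fun t : ℝ => (N:ℝ)⁻¹ * Real.exp (-((((N:ℝ)^2)⁻¹ + ν) * t)))
      (volume.restrict (Ioi 0)) :=
    i4.const_mul _
  have h12 : Integrable (fun t : ℝ => (N:ℝ) * Real.exp (-(1 * t)) - (N:ℝ) * Real.exp (-((1 + ν) * t)))
      (volume.restrict (Ioi 0)) :=
    h1.sub h2
  have h34 : Integrable (fun t : ℝ => (N:ℝ)⁻¹ * Real.exp (-(((N:ℝ)^2)⁻¹ * t)) -
      (N:ℝ)⁻¹ * Real.exp (-((((N:ℝ)^2)⁻¹ + ν) * t))) (volume.restrict (Ioi 0)) :=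
    h3.sub h4
  rw [hptw, integral_add h12 h34, integral_sub h1 h2, integral_sub h3 h4,
    integral_const_mul, integral_const_mul, integral_const_mul, integral_const_mul, v1, v2, v3, v4]
  have : (1 : ℝ) / ((N:ℝ)^2)⁻¹ = (N:ℝ)^2 := by field_simp
  rw [this]; ring

/-- **The natural strengthening is FALSE: the two-scale family does not have the (R)-shape** — its Abel deficit
is `≥ N/2` whenever `ν N² ≥ 1`, although it satisfies the equal-time bound, fixed-`N` integrability, a LINEAR
Green–Kubo integral and a pointwise bulk limit. -/
theorem twoScale_not_regularShape :
    ¬ RegularShape (fun N ν => ∫ t in Ioi (0:ℝ), (1 - Real.exp (-(ν * t))) * twoScale N t) := by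
  intro hR
  obtain ⟨ν₀, hν₀, hRν⟩ := hR (1 / 4) (by norm_num)
  set ν := min (ν₀ / 2) 1 with hν_def
  have hν : 0 < ν := lt_min (by positivity) one_pos
  have hν1 : ν ≤ 1 := min_le_right _ _
  have hνlt : ν < ν₀ := (min_le_left _ _).trans_lt (by linarith)
  obtain ⟨N₀, hN₀⟩ := hRν ν hν hνlt
  -- N large: N ≥ N₀, N ≥ 1, ν N² ≥ 1 (take N ≥ 1/ν)
  obtain ⟨N, hNge⟩ := exists_nat_ge (max (N₀ : ℝ) (1 / ν + 1))
  have hN0 : (N₀ : ℝ) ≤ N := (le_max_left _ _).trans hNge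
  have hN0' : N₀ ≤ N := by exact_mod_cast hN0
  have hNν : 1 / ν + 1 ≤ (N:ℝ) := (le_max_right _ _).trans hNge
  have h1ν : 1 ≤ 1 / ν := by rw [le_div_iff₀ hν]; linarith
  have hN1r : (1:ℝ) ≤ N := by linarith
  have hN1 : 1 ≤ N := by exact_mod_cast hN1r
  have hS := hN₀ N hN0'
  obtain ⟨-, hval⟩ := abelDeficit_twoScale hN1 hν
  simp only at hS
  rw [hval] at hS
  have hS' := (le_abs_self _).trans hS
  -- lower bound of the closed form: first summand ≥ 0, second ≥ N/2
  have hNpos : (0:ℝ) < N := by linarith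
  have hA : 0 ≤ (N:ℝ) * (1 - 1 / (1 + ν)) := by
    apply mul_nonneg hNpos.le
    rw [sub_nonneg, div_le_one (by linarith)]; linarith
  have hνN : 1 ≤ ν * (N:ℝ)^2 := by
    have h1 : 1 / ν ≤ N := by linarith
    have h2 : 1 ≤ ν * N := by rwa [div_le_iff₀' hν] at h1
    nlinarith
  have hB : (N:ℝ) / 2 ≤ (N:ℝ)⁻¹ * ((N:ℝ) ^ 2 - 1 / (((N:ℝ)^2)⁻¹ + ν)) := by
    have hden : 0 < ((N:ℝ)^2)⁻¹ + ν := by positivity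
    have hfrac : 1 / (((N:ℝ)^2)⁻¹ + ν) ≤ (N:ℝ)^2 / 2 := by
      rw [div_le_div_iff₀ hden (by norm_num : (0:ℝ) < 2)]
      have : ((N:ℝ)^2)⁻¹ * (N:ℝ)^2 = 1 := by field_simp
      nlinarith [this]
    have : (N:ℝ)⁻¹ * ((N:ℝ)^2 / 2) = N / 2 := by field_simp
    calc (N:ℝ) / 2 = (N:ℝ)⁻¹ * ((N:ℝ)^2 - (N:ℝ)^2 / 2) := by field_simp; ring
      _ ≤ (N:ℝ)⁻¹ * ((N:ℝ) ^ 2 - 1 / (((N:ℝ)^2)⁻¹ + ν)) := by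
          apply mul_le_mul_of_nonneg_left _ (by positivity)
          linarith
  linarith

/-! ## §C Line `Sketch` (zero-mean-dyadic-splice) — pre-assessment, nothing killed (prose only)

* P3 `ZeroMeanWindowLemma`: TRUE as stated (checked on paper).  With `W(t) = χ(t/τ)(1 − e^{−νt})`,
  two integrations by parts give `Ŵ(ω) := ∫₀^∞ W cos(ωt) = −W′(0)/ω² − ω⁻² ∫ W″ cos(ωt)`, `W′(0) = ν`,
  `∫₀^{τ/2} W″cos = −ν³/(ν²+ω²) + O(ν e^{−ντ/2})`, `∫_{τ/2}^{τ} |W″| = O(τ⁻¹ + ν)`; hence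
  `|Ŵ(ω)| ≤ ν/(ν²+ω²) + K(τ⁻¹+ν)/ω²` off the window and `∫_ℝ Ŵ = πW(0) = 0`; on the window Ŵ is an approximate
  identity of width ν minus one of width 1/τ, so `∫_{|ω|<δ₀} |Ŵ| H|ω|^α = O(ν^α + τ^{−α})` (uses
  `|χ̂(s)| ≲ (1+s²)⁻¹`, true for the C² smooth-step).  Total `K(ν^α + τ^{−α} + ν)` with `K = K(H, α, δ₀, σ(ℝ), g 0)`.
* K3 `LinearHorizonSplice`: pins `C(t) = lim_N (c_{N+1} − c_N)(t)` and `E(t) = lim_N (c_N − (N−1)C)(t)` uniquely,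
  so K4 is not junk-quantified.  The exponential error `K e^{−c(N − t/c₀)}` at `t ≤ c₀N` is consistent with
  fluctuating hydrodynamics (image terms `e^{−N²/4Dt}`); thermal supersonic excitations cost an N-independent
  Boltzmann factor but must survive a distance ≍ N, again exponential.  Not cheaply refutable; `twoScale`-type slow
  components of amplitude `1/N` would violate it (they are what it excludes).
* K4 `HoelderWindowDensity`: physically α = 1/2 (bulk tail `t^{−3/2}` ⇒ `g(ω) − g(0) ∝ −|ω|^{1/2}`).  NOTE for
  the lead: demanded at EVERY `T > 0`; this route's `DrudeDissolution` gives only continuity and only `T < T₀`.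
* K1 `PostCrossingSaturation`: FH predicts `∫_ξ^∞ c_N = O(N ξ^{−1/2}) + O(ξ^{−1/2})` for `ξ ≥ c₀N`, i.e. `δ = 1/2`.
* Composition (DirectCompositionShape): sound on paper — S_N(ν) = ∫W_N c_N + Λ_N, splice error `≤ K c₀/c = O(1)`
  (NOT exponentially small, but harmless), Bonnet on the non-decreasing late weight.  No gap found.

REGISTERED SKELETON `Lines/Sketch.lean` rev 1 (lead, 07:09Z) — the five stubs checked on paper, NONE KILLED:
* `stub_monotoneWindow` (P2): TRUE — Bonnet/Abel summation `∫_a^∞ L c = ∫ (∫_s^∞ c) dL(s)`, `0 ≤ L ≤ 1` on `(a,∞)` from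
  monotonicity and `L a = 0`; a negative `B` makes the tail hypothesis unsatisfiable (vacuous), fine.
* `stub_windowTransform` (P3a): TRUE WITH THE STATED CONSTANTS.  `χ` is the C¹ cubic smooth-step, `χ″(s) = 24(2u−1)`
  (`u = 2s−1`) piecewise, `∫|(χ(·/τ))″| = 6/τ`, total variation of `χ(·/τ)` = 1.  Two integrations by parts
  (`W(0) = 0`, `W′(0) = ν`, `W′` absolutely continuous, `W` supported in `[0,τ]`):
  `Ŵ(ω) = −ω⁻²(W′(0) + ∫₀^∞ W″cos ωt)`, `∫W″cos = −ν³/(ν²+ω²) + R`, `|R| ≤ 6/τ + 3ν e^{−ντ/2} ≤ (6/τ)(1 + 1/e) < 12/τ`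
  (using `x e^{−x} ≤ 1/e`, `x = ντ/2`), hence `|Ŵ(ω) + ν/(ν²+ω²)| ≤ 12/(τω²)` ✓ (margin ≈ 8.2 vs 12).  Zero-mean bound:
  `∫_{(−δ,δ)} Ŵ = 2∫₀^ν Im F(s − iδ) ds`, `F(z) = 1/z + z⁻²∫(χ(·/τ))″e^{−zt}`, `|F(z) − 1/z| ≤ 6/(τ(s²+δ²))`,
  `Im(1/(s−iδ)) = δ/(s²+δ²) ≤ 1/δ` ⇒ `|∫_{(−δ,δ)} Ŵ| ≤ 2ν/δ + 12ν/(τδ²) ≤ 12ν(1/δ + 1/(τδ²))` ✓.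
* `stub_zeroMeanWindow` (P3b): TRUE — far part `≤ σ(ℝ)(ν + M/τ)/δ₀²`; near part `g(0)·Mν(1/δ₀ + 1/(τδ₀²))` +
  `(σ(ℝ) + 2δ₀ g 0)(ν + M/τ)/r²` + `η·(π + 4√M)` with `r = r(η)` from continuity of `g` at `0` and
  `∫ min(τ, ν/(ν²+ω²) + M/(τω²)) dω ≤ π + 4√M` (split at `ω* = √M/τ`) ✓; choose `η`, then `ν₁, τ₁`.
* `stub_bulkContactSplice` / `stub_postCrossingTails` (physical, XL): consistent with the FH caricature below (integrated
  splice error from image terms `e^{−N²/4Dt}` is `O(e^{−N/(4Dc₀)})`; diffusive boundary layers reach only `√(D c₀ N) ≪ N`);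
  the two-scale family of §B violates exactly `stub_postCrossingTails` (`∫_ξ^∞ twoScale N ≈ N e^{−ξ/N²} ≈ N` at `ξ = c₀N`).
  `stub_postCrossingTails` is where `lam, β > 0` must act (harmonic corner: `∫_ξ^∞ c_N` makes excursions `≍ N²`, §A.2).

LINEAR FLUCTUATING-HYDRODYNAMICS CARICATURE (closed forms, for calibration; energies `e ∈ ℝ^N`, `de = −Ae dt + dW`,
`A = D·Lap_path + σ(P_0 + P_{N−1})`, stationary covariance `T²·Id`, bond currents `j_i = −D(e_{i+1} − e_i) + √(2DT²)ξ_i`,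
contact currents `∓σ e_b + √(2σT²)ξ_b`):  `J_tot = −D(e_{N−1} − e_0) + √(2DT²) Σ_i ξ_i`, and for `t > 0` EXACTLY
`c_N(t) = −D²T² wᵀe^{−At}w` (`w = δ_{N−1} − δ_0`; the noise–response cross term is `−2×` the `uu`-term by the
fluctuation–dissipation relation, flipping its sign), so the whole non-white part of `c_N` is a NEGATIVE boundary
term of amplitude `O(1)` in `N`, with `∫₀^∞ = −D²T² wᵀA⁻¹w = −2D²T²/(σ + 2D/(N−1)) = O(1)` and
`S_N(ν) = −D²T² wᵀ(A⁻¹ − (A+ν)⁻¹)w`, `|S_N(ν)| ≤ 2D²T²/σ` uniformly in `N` AND `ν`.  Numbers (D = σ = T = 1,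
local script `fh_caricature.py`, tridiagonal solves): `∫₀^∞ b = −1.9216, −1.9604, −1.9801, −1.9900, −1.9950` for
`N = 50, 100, 200, 400, 800` (= `−2/(1 + 2/(N−1))` to 4 digits); boundary slow part `S_N(ν)` at
`ν = 10⁻¹, 10⁻², 10⁻³, 10⁻⁴`: `N = 50: −0.462, −0.114, −0.015, −0.002`; `N = 800: −0.535, −0.185, −0.057, −0.015`
(≈ `−1.7√ν`, saturating in `N`: the boundary term's own `t^{−3/2}` tail), i.e. NEVER comparable to `εN`.  Sum rule check: white part
`DT²(N−1)` plus boundary part gives `∫₀^∞ c_N = (N−1)²T²D/((N−1) + 2D/σ) = (N−1)T²D_N` with the series conductance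
`D_N = (N−1)/((N−1)/D + 2/σ)` ✓ (Fourier + two Kapitza resistances).  In the caricature (R) therefore holds with an
`O(1)` deficit; the only `N`-extensive slow contribution in the real chain is the bulk one, `N·∫(1−e^{−νt})C_T`, of size
`≍ N√ν` if `C_T ∼ t^{−3/2}` (the strategists' predicted modulus), which is exactly what K4/P3 of the Sketch line and
`DrudeDissolution`-type inputs are meant to control.
-/

/-! ## §D Near-misses (sorried; work-file only) -/

/-- NEAR-MISS (unconditional harmonic failure).  Obstruction: the three hypotheses of `regularAt_harmonic_false`
are landed only for `0 < β` (`NessUnique_holds`, `kuboAbelIdentity_holds` via `pinnedChain_uniformMixing hω hl.le hβ`,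
`stub_equalTimeBound` via `pinnedChain_integral_sq_bondCurrent_gibbsMeasure_le … hl hβ`).  Extending those proofs to
`β = 0` (the Lyapunov/minorisation and moment bounds use the quartic coupling for convenience, not necessity at
`ω₂ > 0`) would make this unconditional; not attempted in cycle 1 (multi-file generalisation of landed theory). -/
theorem regularAt_harmonic_false_unconditional {ω₂ γ T : ℝ} (hω : 0 < ω₂) (hγ : 0 < γ) (hT : 0 < T) :
    ¬ RegularAt ω₂ 0 0 γ T := by
  sorry

end Summit.AtomisticToContinuum.FouriersLaw.Cruxes.UniformAbelianRegularity.Disproof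

end
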